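import Summits.QuantumFields.BalabanUV.Beta.FP.SliceVertex
import Summits.QuantumFields.BalabanUV.Beta.FP.BubbleGermValue

/-!
# `BalabanUV.Beta.FP.SliceCubicGerm` — road «FP» for binder row D1, row H2V-2 (owner b2b-balaban-beta-d1-p3, R-FP-23 ∕ `H2V-DESIGN.md` §4), part 2 of 2:
# THE CUBIC GERM OF THE LATTICE BACKGROUND-FEYNMAN SLICE IS `sliceGerm` — `cubicGermOf (sliceA 3) = BubbleGermValue.sliceGerm`, the level-0 BF family
# `wilsonA + sliceA` has germ `bfGerm`, and THREE READINGS AGREE (`ymGerm = bfGerm − sliceGerm` from the lattice side alone)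

HONEST DEPENDENCY (page 1, mandatory): continuum YM on T⁴ ⇐ BetaPertH ∧ nine spine estimates (0/9 proved); BetaPertH ⇐ (D1) ∧ (D4) ∧ CAP+tail;
G-an2-4 gates asym, D1 and NE2/3/4.  HONEST FRAMING (cell contract, verbatim): «discharging `BetaPertH` makes Bałaban's UV stability UNCONDITIONAL —
a real constructive-QFT result; it is NOT the continuum limit and NOT the Clay problem.»  THIS MODULE DISCHARGES NOTHING of the wall: list moments
(`FP/GradedStencilMoments`), one `ℓ¹` re-indexing and Kronecker-delta algebra over part 1 (`FP/SliceVertex`: the slice vertex `sliceVertex₁ = (−2)•divVertex`,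
its `ℤ⁴` stencil `sliceStn`, the packed-fibre family `sliceA` in `StepJetData` §5's `ad(t_c)`-stripping convention).  `[our object]`∕`[folklore]` throughout;
nothing cited, no `def … : Prop`, no `sorry`, no new definition.  NOT the perfect action's jets (H2V-4), NOT H2-ASM, NOT hgerm, NOT (CONV-C), NOT D1, NOT BetaPertH,
NOT continuum, NOT Clay.

ABSOLUTE RULE (cell charter, verbatim): «No internally-minted statement may enter as a cited fact. Every hypothesis is either kernel-proved in this package or a
verbatim quotation of a PUBLISHED theorem with page reference. The manuscript(s) under audit are NOT citable for their own disputed steps — they are the thing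
under adjudication; programme-internal (2001/route/tribunal) claims are never citable.»

THE INDEX CONVENTION is `WilsonCubicGerm`'s (verbatim): `cubicGermOf S μ ν λ κ i = ∑'_{(x,z) ∈ ℤ⁴×ℤ⁴} S λ 0 x z (inl μ) (inl ν) · (x_κ if i = 0, z_κ if i = 1)` —
leg 1 = the ROW fluctuation leg `(x, μ)` (momentum `p`), leg 2 = the COLUMN fluctuation leg `(z, ν)` (momentum `q`), leg 3 = the BACKGROUND bond `(0, λ)`.

WHAT IS PROVED.
* §4 THE GERM (`d = 3`): `sEntry_eq_real` (the colourless slice entry IS an entry of the realised `ℤ⁴` stencil `sliceStn λ 1`), the antisymmetrised pairing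
  dictionary `hasSum_sliceA_mul` ∕ `tsum_sliceA_mul` ∕ `hasSum_sliceA_mul_at` (`GradedStencilMoments.hasSum_real_apply_mul` BY NAME), **`tsum_sliceA_eq_zero`**
  (TOTAL mass zero — the zero-mass letter H2-ASM-1's double smear expansion uses; LOCATED `sEntry_rowLeg`: leg-wise zeroth moments do NOT vanish for the
  slice vertex `(∂·Q)[B_λ, Q_λ]` — the divergence leg annihilates constants, the undifferentiated leg does not), `cubicGermOf_sliceA_eq_moments`, and
  **`cubicGermOf_sliceA : cubicGermOf (sliceA 3) = BubbleGermValue.sliceGerm`** (p-part `δ_{μκ}δ_{νλ}`, q-part `−δ_{νκ}δ_{μλ}`, coefficient EXACTLY ONE relative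
  to `cubicGermOf (wilsonA 3) = ymGerm`): the germ t4-ne9-formalise-leaf-03 typed from Abbott's continuum `ξ = 1` gauge-fixing vertex `f^{abc}(∂_κQ^b_κ)(B^a_λQ^c_λ)`
  IS the germ of the lattice slice in the cell's conventions; corollaries `anti12_sliceA` (BY NAME; the slice germ is NOT `Anti13` — its third leg is the
  background), **`cubicGermOf_bf : cubicGermOf (fun λ u => wilsonA 3 λ u + sliceA 3 λ u) = bfGerm`** (`cubicGermOf_wilsonA` + additivity under the two `HasSum`s).
* §5 THREE READINGS AGREE (list level, `SliceVertex.germOfStn`): `cubicGermOf_eq_germOfStn` (both `cubicGermOf`s of record are germs read from list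
  moments); **`germOfStn_vecStn : germOfStn (vecStn sTot · 1) = bfGerm`** — the Wilson CURRENT + `sTot`·SPIN part ALONE already has the background-Feynman germ
  (exactly `bfGerm_apply`'s pattern `sgn_i·δ_{μν}δ_{λκ} + 2·δ_{μκ}δ_{νλ} − 2·δ_{μλ}δ_{νκ}`); `germOfStn_divStn_sliceStn_remStn`: the longitudinal part `2•divStn` has
  germ `−sliceGerm`, the slice stencil `+sliceGerm`, the `Graded 2` remainder none; **`cubicGermOf_wilsonA_decomposed`** (v1.1): on the LATTICE side
  `cubicGermOf (wilsonA 3) = germOfStn (vecStn sTot · 1) + germOfStn (2•divStn · 1) + germOfStn (remStn · 1)` with the summands `= bfGerm`, `= −sliceGerm`, `= 0` —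
  each a list-moment computation compared with a germ DEFINED (by t4-ne9-leaf-03) from the continuum Lagrangian `¼F² + ½(D^B·Q)²`: the sign of `sliceGerm`
  relative to `ymGerm` is thereby checked against the group product `U_b = e^{W_b}e^{B_b}`, not chosen; `three_readings` packages `ymGerm = bfGerm − sliceGerm`
  (AS STATED = `bfGerm`'s definition read backwards — v1.1 DOCFIX, self-objection F-leaf02-g38-1) with `cubicGermOf (wilsonA 3 + sliceA 3) = ymGerm + sliceGerm`.
Provenance: G-an2-4 formalisation swarm seat b2b-balaban-gan24-formalise-leaf-02 gen 38 (cross-lane on road FP, first refusal R-FP-23 (c)), 2026-08-20∕21.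
-/

noncomputable section

namespace Summit.QuantumFields.BalabanUV.Beta.FP.SliceCubicGerm

open Finset
open scoped BigOperators Matrix
open Literature.MathematicalPhysics.QuantumFieldTheory.Balaban1983to89
open Literature.MathematicalPhysics.QuantumFieldTheory.Balaban1983to89.Beta
open Literature.MathematicalPhysics.QuantumFieldTheory.Balaban1983to89.Beta.DyadicShell (Pt)
open Literature.MathematicalPhysics.QuantumFieldTheory.Balaban1983to89.Beta.GradedBubbles (LP Stn smulS Graded)
open Literature.MathematicalPhysics.QuantumFieldTheory.Balaban1983to89.Beta.SpinTable (spinMat)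
open Literature.MathematicalPhysics.QuantumFieldTheory.Balaban1983to89.Beta.GhostTable (copies)
open Literature.MathematicalPhysics.QuantumFieldTheory.Balaban1983to89.Beta.PlaquetteWeitzenbock (sTot)
open Literature.MathematicalPhysics.QuantumFieldTheory.Balaban1983to89.Beta.PlaquetteStencil (dirBlock)
open Literature.MathematicalPhysics.QuantumFieldTheory.Balaban1983to89.Beta.StepJetData (wilsonA)
open Literature.MathematicalPhysics.QuantumFieldTheory.Balaban1983to89.Beta.ExpKernelCalculus (MKer shiftK)
open B6BondElimination (unitVec unitVec_apply)
open Summit.QuantumFields.BalabanUV.Beta.GradedStencilDictionary (real lift)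
open Summit.QuantumFields.BalabanUV.Beta.FP.GradedStencilMoments
open Summit.QuantumFields.BalabanUV.Beta.WilsonStencilZ4 (divStn vecStn mainStn remStn wilsonStn)
open Summit.QuantumFields.BalabanUV.Beta.FP.MarginalUniqueness (CubicGerm ymGerm δ δ_comm Anti12)
open Summit.QuantumFields.BalabanUV.Beta.FP.WilsonCubicGerm (cubicGermOf lift_unitVec_self moments_divStn blocks_apply_unit ite_eq_δ hasSum_wilsonA_mul
  cubicGermOf_wilsonA cubicGermOf_wilsonA_eq_moments moments_mainStn moments_remStn)
open Summit.QuantumFields.BalabanUV.Beta.FP.BubbleGermValue (sgn sliceGerm bfGerm bfGerm_apply sliceGerm_anti12)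
open Summit.QuantumFields.BalabanUV.Beta.FP.SliceVertex

/-! ## §4 The germ (`d = 3`): pairing dictionary, total mass zero, `cubicGermOf (sliceA 3) = sliceGerm`, the BF family's germ -/

section Germ

/-- [folklore] **the colourless slice ENTRY at the background site `0` is an ENTRY OF THE REALISED `ℤ⁴` STENCIL** `sliceStn λ 1`
(`real_sliceStn` on `Λ := ℤ⁴`, `C := Unit`, `A := 1`). -/
theorem sEntry_eq_real (lam : Fin 4) (x z : Fin 4 → ℤ) (μ ν : Fin 4) :
    sEntry 3 lam 0 x z μ ν = real (unitVec (d := 4)) (0 : Fin 4 → ℤ) 0 (sliceStn lam (1 : Matrix Unit Unit ℝ)) (x, ((), μ)) (z, ((), ν)) := by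
  unfold sEntry
  rw [real_sliceStn]

/-- [folklore] **THE ANTISYMMETRISED PAIRING DICTIONARY**: for EVERY weight `φ` on pairs of sites, pairing the level-0 slice family (background bond
`(λ, 0)`, field–field block) against `φ` over all of `ℤ⁴ × ℤ⁴` is the antisymmetrised list pairing of `sliceStn λ 1`. -/
theorem hasSum_sliceA_mul (lam μ ν : Fin 4) (φ : (Fin 4 → ℤ) → (Fin 4 → ℤ) → ℝ) :
    HasSum (fun xz : (Fin 4 → ℤ) × (Fin 4 → ℤ) => sliceA 3 lam 0 xz.1 xz.2 (Sum.inl μ) (Sum.inl ν) * φ xz.1 xz.2)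
      ((1 / 2 : ℝ) *
        ((((sliceStn lam (1 : Matrix Unit Unit ℝ)).map fun p => p.m ((), μ) ((), ν) * φ p.x p.y).sum) -
          ((sliceStn lam (1 : Matrix Unit Unit ℝ)).map fun p => p.m ((), ν) ((), μ) * φ p.y p.x).sum)) := by
  have h1 := hasSum_real_apply_mul (unitVec (d := 4)) (sliceStn lam (1 : Matrix Unit Unit ℝ)) ((), μ) ((), ν) φ
  have h2 := hasSum_real_apply_mul_swap (unitVec (d := 4)) (sliceStn lam (1 : Matrix Unit Unit ℝ)) ((), ν) ((), μ) φ
  simp only [lift_unitVec_self] at h1 h2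
  refine ((h1.sub h2).mul_left (1 / 2 : ℝ)).congr_fun fun xz => ?_
  rw [sliceA_inl_inl, sEntry_eq_real, sEntry_eq_real]
  ring

/-- [folklore] the `∑'` form of the antisymmetrised pairing dictionary. -/
theorem tsum_sliceA_mul (lam μ ν : Fin 4) (φ : (Fin 4 → ℤ) → (Fin 4 → ℤ) → ℝ) :
    ∑' xz : (Fin 4 → ℤ) × (Fin 4 → ℤ), sliceA 3 lam 0 xz.1 xz.2 (Sum.inl μ) (Sum.inl ν) * φ xz.1 xz.2 =
      (1 / 2 : ℝ) *
        ((((sliceStn lam (1 : Matrix Unit Unit ℝ)).map fun p => p.m ((), μ) ((), ν) * φ p.x p.y).sum) -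
          ((sliceStn lam (1 : Matrix Unit Unit ℝ)).map fun p => p.m ((), ν) ((), μ) * φ p.y p.x).sum) :=
  (hasSum_sliceA_mul lam μ ν φ).tsum_eq

/-- [folklore] **TRANSLATION COVARIANCE OF THE PAIRING**: the same list pairing computes the pairing of the member with background bond `(λ, u)` at ANY site
`u` against the weight read RELATIVE TO `u` (`sliceA_translate` + re-indexing `ℤ⁴ × ℤ⁴`). -/
theorem hasSum_sliceA_mul_at (lam μ ν : Fin 4) (u : Fin 4 → ℤ) (φ : (Fin 4 → ℤ) → (Fin 4 → ℤ) → ℝ) :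
    HasSum (fun xz : (Fin 4 → ℤ) × (Fin 4 → ℤ) => sliceA 3 lam u xz.1 xz.2 (Sum.inl μ) (Sum.inl ν) * φ (xz.1 - u) (xz.2 - u))
      ((1 / 2 : ℝ) *
        ((((sliceStn lam (1 : Matrix Unit Unit ℝ)).map fun p => p.m ((), μ) ((), ν) * φ p.x p.y).sum) -
          ((sliceStn lam (1 : Matrix Unit Unit ℝ)).map fun p => p.m ((), ν) ((), μ) * φ p.y p.x).sum)) := by
  have h := hasSum_sliceA_mul lam μ ν φ
  have ht := sliceA_translate (d := 3) lam 0 u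
  rw [zero_add] at ht
  refine (((Equiv.addRight u).prodCongr (Equiv.addRight u)).hasSum_iff).mp (h.congr_fun fun xz => ?_)
  simp only [Function.comp_apply, Equiv.prodCongr_apply, Prod.map_fst, Prod.map_snd, Equiv.coe_addRight, add_sub_cancel_right, ht,
    ExpKernelCalculus.shiftK, add_neg_cancel_right]

/-- [our object] **THE TOTAL MASS OF THE SLICE FAMILY VANISHES**: `Σ'_{(x,z)} sliceA 3 λ 0 x z (inl μ) (inl ν) = 0` (`sliceStn` is `Graded 1`) — the
zero-mass letter H2-ASM-1's double smear expansion uses. -/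
theorem tsum_sliceA_eq_zero (lam μ ν : Fin 4) :
    ∑' xz : (Fin 4 → ℤ) × (Fin 4 → ℤ), sliceA 3 lam 0 xz.1 xz.2 (Sum.inl μ) (Sum.inl ν) = 0 := by
  have h := tsum_sliceA_mul lam μ ν fun _ _ => (1 : ℝ)
  simp only [mul_one] at h
  rw [h, ← mom0_apply, ← mom0_apply, (moments_sliceStn lam (1 : Matrix Unit Unit ℝ) 0).1, Matrix.zero_apply, Matrix.zero_apply, sub_zero,
    mul_zero]

/-- [folklore] LOCATED (leg-wise masses): the ROW leg of the slice entry does NOT annihilate constants — at the column site `u + e_{κ′}` the row-leg sum is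
`Σ_x s(x,α; u+e_{κ′},β) = −2·[α = κ′]·(1 − [e_β = 0]) = −2·[α = κ′]` — while the COLUMN (divergence) leg does: `s(x,α;·,β)` is a difference of two
indicator functions of `z`.  Only the TOTAL mass (`tsum_sliceA_eq_zero`) vanishes. -/
theorem sEntry_rowLeg (κ' : Fin 4) (u : Fin 4 → ℤ) (α β : Fin 4) :
    sEntry 3 κ' u u (u + unitVec κ') α β = -2 * (if α = κ' then (1 : ℝ) else 0) ∧
      sEntry 3 κ' u u (u + unitVec κ') α β + sEntry 3 κ' u u (u + unitVec κ' - unitVec β) α β = 0 := by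
  have hne : (u + unitVec κ' : Fin 4 → ℤ) ≠ u + unitVec κ' - unitVec β := by
    intro h
    have h' := congr_fun h β
    simp only [Pi.add_apply, Pi.sub_apply, unitVec_apply, if_true] at h'
    omega
  have hne' : (u + unitVec κ' - unitVec β : Fin 4 → ℤ) ≠ u + unitVec κ' := fun h => hne h.symm
  refine ⟨?_, ?_⟩
  · rw [sEntry_apply]
    by_cases hα : α = κ' <;> simp [hα, hne]
  · rw [sEntry_apply, sEntry_apply]
    by_cases hα : α = κ' <;> simp [hα, hne, hne']

/-- [folklore] THE GERM OF `sliceA` THROUGH THE LIST MOMENTS of `sliceStn λ 1`: `p`-part `= ½·((momX)_{μν} − (momY)_{νμ})`, `q`-part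
`= ½·((momY)_{μν} − (momX)_{νμ})` (verbatim the shape of `WilsonCubicGerm.cubicGermOf_wilsonA_eq_moments`). -/
theorem cubicGermOf_sliceA_eq_moments (μ ν lam κ : Fin 4) (i : Fin 2) :
    cubicGermOf (sliceA 3) μ ν lam κ i =
      (1 / 2 : ℝ) *
        (if i = 0 then
          momX (sliceStn lam (1 : Matrix Unit Unit ℝ)) κ ((), μ) ((), ν) - momY (sliceStn lam (1 : Matrix Unit Unit ℝ)) κ ((), ν) ((), μ)
        else
          momY (sliceStn lam (1 : Matrix Unit Unit ℝ)) κ ((), μ) ((), ν) - momX (sliceStn lam (1 : Matrix Unit Unit ℝ)) κ ((), ν) ((), μ)) := by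
  obtain ⟨ax, ay⟩ := moments_apply (sliceStn lam (1 : Matrix Unit Unit ℝ)) κ ((), μ) ((), ν)
  obtain ⟨bx, by'⟩ := moments_apply (sliceStn lam (1 : Matrix Unit Unit ℝ)) κ ((), ν) ((), μ)
  unfold cubicGermOf
  fin_cases i
  · simp only [Fin.zero_eta, Fin.isValue, ↓reduceIte]
    rw [ax, by']
    exact tsum_sliceA_mul lam μ ν fun x _ => ((x κ : ℤ) : ℝ)
  · simp only [Fin.mk_one, Fin.isValue, one_ne_zero, ↓reduceIte]
    rw [ay, bx]
    exact tsum_sliceA_mul lam μ ν fun _ z => ((z κ : ℤ) : ℝ)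

/-- [our object] **THE CUBIC GERM OF THE LATTICE BACKGROUND-FEYNMAN SLICE IS `sliceGerm`** — p-part `δ_{μκ}δ_{νλ}`, q-part `−δ_{νκ}δ_{μλ}`, coefficient
EXACTLY ONE relative to `cubicGermOf (wilsonA 3) = ymGerm`: the germ t4-ne9-formalise-leaf-03 typed from Abbott's continuum `ξ = 1` vertex
`f^{abc}(∂_κQ^b_κ)(B^a_λQ^c_λ)` (`BubbleGermValue.sliceGerm`) IS the germ of `½|D*_BW|²` on the lattice in the cell's conventions. -/
theorem cubicGermOf_sliceA : cubicGermOf (sliceA 3) = sliceGerm := by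
  funext μ ν lam κ i
  obtain ⟨-, sx, sy⟩ := moments_sliceStn lam (1 : Matrix Unit Unit ℝ) κ
  obtain ⟨-, -, d1⟩ := blocks_apply_unit lam κ μ ν
  obtain ⟨-, -, d2⟩ := blocks_apply_unit lam κ ν μ
  rw [cubicGermOf_sliceA_eq_moments, sx, sy]
  simp only [Matrix.smul_apply, Matrix.zero_apply, smul_eq_mul, d1, d2, sliceGerm]
  split_ifs <;> ring

/-- [our object] COROLLARY: Bose antisymmetry `1 ↔ 2` of the slice germ (BY NAME from `sliceGerm`'s; the slice germ is NOT `Anti13` — its third leg is the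
background). -/
theorem anti12_sliceA : Anti12 (cubicGermOf (sliceA 3)) := by
  rw [cubicGermOf_sliceA]; exact sliceGerm_anti12

/-- [our object] **THE GERM OF THE LEVEL-0 BACKGROUND-FEYNMAN FAMILY `wilsonA + sliceA` IS `bfGerm = ymGerm + sliceGerm`** (t4-ne9-leaf-03's
`BubbleGermValue.bfGerm`, whose bubble on free legs is the background-field value `4T − 2S`). -/
theorem cubicGermOf_bf : cubicGermOf (fun lam u => wilsonA 3 lam u + sliceA 3 lam u) = bfGerm := by
  funext μ ν lam κ i
  have hw := hasSum_wilsonA_mul lam μ ν fun x z => (((if i = 0 then x κ else z κ : ℤ)) : ℝ)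
  have hs := hasSum_sliceA_mul lam μ ν fun x z => (((if i = 0 then x κ else z κ : ℤ)) : ℝ)
  have hb : bfGerm μ ν lam κ i = cubicGermOf (wilsonA 3) μ ν lam κ i + cubicGermOf (sliceA 3) μ ν lam κ i := by
    rw [cubicGermOf_wilsonA, cubicGermOf_sliceA]; rfl
  rw [hb]
  unfold cubicGermOf
  rw [hw.tsum_eq, hs.tsum_eq, ← (hw.add hs).tsum_eq]
  refine tsum_congr fun xz => ?_
  simp only [Pi.add_apply, add_mul]

end Germ

/-! ## §5 Three readings agree: the germ read from list moments of the Wilson pieces and of the slice -/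

section Readings

/-- [folklore] the two `cubicGermOf`s of record ARE germs read from list moments. -/
theorem cubicGermOf_eq_germOfStn :
    cubicGermOf (wilsonA 3) = germOfStn (fun lam => wilsonStn lam (1 : Matrix Unit Unit ℝ)) ∧
      cubicGermOf (sliceA 3) = germOfStn (fun lam => sliceStn lam (1 : Matrix Unit Unit ℝ)) := by
  refine ⟨?_, ?_⟩
  · funext μ ν lam κ i; rw [cubicGermOf_wilsonA_eq_moments]; rfl
  · funext μ ν lam κ i; rw [cubicGermOf_sliceA_eq_moments]; rfl

/-- [our object] **READING 1 — THE WILSON CURRENT + `sTot`·SPIN PART ALONE HAS THE BACKGROUND-FEYNMAN GERM**: `germOfStn (vecStn sTot · 1) = bfGerm`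
(colour current `±[λ=κ]δ_{μν}`, spin vertex with `sTot = −2` giving `2(δ_{μκ}δ_{νλ} − δ_{μλ}δ_{νκ})` — exactly `bfGerm_apply`'s pattern
`sgn_i·δ_{μν}δ_{λκ} + 2·δ_{μκ}δ_{νλ} − 2·δ_{μλ}δ_{νκ}`). -/
theorem germOfStn_vecStn : germOfStn (fun lam => vecStn sTot lam (1 : Matrix Unit Unit ℝ)) = bfGerm := by
  funext μ ν lam κ i
  obtain ⟨mx, my⟩ := moments_mainStn lam (1 : Matrix Unit Unit ℝ) κ
  obtain ⟨dx, dy⟩ := moments_divStn lam (1 : Matrix Unit Unit ℝ) κ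
  obtain ⟨-, ax, ay⟩ := moments_append (vecStn sTot lam (1 : Matrix Unit Unit ℝ)) (smulS 2 (divStn lam (1 : Matrix Unit Unit ℝ))) κ
  obtain ⟨-, sx, sy⟩ := moments_smulS (2 : ℝ) (divStn lam (1 : Matrix Unit Unit ℝ)) κ
  have hx : momX (vecStn sTot lam (1 : Matrix Unit Unit ℝ)) κ =
      (if κ = lam then (1 : ℝ) else 0) • copies (Fin 4) (1 : Matrix Unit Unit ℝ) + (2 : ℝ) • spinMat κ lam (1 : Matrix Unit Unit ℝ) := by
    have h := mx
    rw [mainStn, ax, sx, dx, smul_zero, add_zero] at h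
    exact h
  have hy : momY (vecStn sTot lam (1 : Matrix Unit Unit ℝ)) κ =
      -((if κ = lam then (1 : ℝ) else 0) • copies (Fin 4) (1 : Matrix Unit Unit ℝ)) + (2 : ℝ) • spinMat κ lam (1 : Matrix Unit Unit ℝ) := by
    have h := my
    rw [mainStn, ay, sy, dy] at h
    exact add_right_cancel h
  obtain ⟨c1, s1, -⟩ := blocks_apply_unit κ lam μ ν
  obtain ⟨c2, s2, -⟩ := blocks_apply_unit κ lam ν μ
  simp only [germOfStn, hx, hy, Matrix.add_apply, Matrix.smul_apply, Matrix.neg_apply, smul_eq_mul, c1, s1, c2, s2, ite_eq_δ, bfGerm_apply, sgn,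
    δ_comm κ lam, δ_comm ν μ, δ_comm κ μ, δ_comm lam ν, δ_comm κ ν, δ_comm μ lam]
  split_ifs <;> ring

/-- [our object] **READING 2 — THE LONGITUDINAL PART OF THE WILSON STENCIL HAS GERM `−sliceGerm`, THE SLICE STENCIL `+sliceGerm`, THE REMAINDER NONE**:
`germOfStn (2•divStn · 1) = −sliceGerm`, `germOfStn (sliceStn · 1) = sliceGerm`, `germOfStn (remStn · 1) = 0`. -/
theorem germOfStn_divStn_sliceStn_remStn :
    germOfStn (fun lam => smulS 2 (divStn lam (1 : Matrix Unit Unit ℝ))) = -sliceGerm ∧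
      germOfStn (fun lam => sliceStn lam (1 : Matrix Unit Unit ℝ)) = sliceGerm ∧
        germOfStn (fun lam => remStn lam (1 : Matrix Unit Unit ℝ)) = 0 := by
  have hs : germOfStn (fun lam => sliceStn lam (1 : Matrix Unit Unit ℝ)) = sliceGerm := by
    rw [← cubicGermOf_eq_germOfStn.2, cubicGermOf_sliceA]
  refine ⟨?_, hs, ?_⟩
  · have h2 : (fun lam => smulS 2 (divStn lam (1 : Matrix Unit Unit ℝ))) = fun lam => smulS (-1) (sliceStn lam (1 : Matrix Unit Unit ℝ)) := by
      funext lam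
      rw [sliceStn, GradedBubbles.smulS, GradedBubbles.smulS, GradedBubbles.smulS, List.map_map]
      refine List.map_congr_left fun p _ => ?_
      simp only [Function.comp_apply, smul_smul]
      norm_num
    rw [h2, (germOfStn_append_smulS (fun lam => sliceStn lam (1 : Matrix Unit Unit ℝ)) (fun _ => []) (-1)).2, hs, neg_one_smul]
  · funext μ ν lam κ i
    obtain ⟨rx, ry⟩ := moments_remStn lam (1 : Matrix Unit Unit ℝ) κ
    simp only [germOfStn, rx, ry, Matrix.zero_apply, sub_zero, ite_self, mul_zero, Pi.zero_apply]

/-- [our object] **READING 3 — THE THREE READINGS AGREE**: `ymGerm = bfGerm − sliceGerm` and `cubicGermOf (wilsonA 3 + sliceA 3) = ymGerm + sliceGerm`.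
HONEST (v1.1 DOCFIX, self-objection F-leaf02-g38-1): conjunct 1 AS STATED is t4-ne9-leaf-03's DEFINITION `bfGerm := ymGerm + sliceGerm` read backwards (its PROOF
below runs through the lattice decomposition, its STATEMENT does not need it); the lattice-side CONTENT is `cubicGermOf_wilsonA_decomposed` (v1.1, next) with
`germOfStn_vecStn` ∕ `germOfStn_divStn_sliceStn_remStn`: three list-moment computations, each compared with a germ DEFINED from the continuum Lagrangian
`¼F² + ½(D^B·Q)²` — that is where the relative sign of the slice germ is checked against the group product `U_b = e^{W_b}e^{B_b}`; conjunct 2 is `cubicGermOf_bf`. -/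
theorem three_readings : ymGerm = bfGerm - sliceGerm ∧ cubicGermOf (fun lam u => wilsonA 3 lam u + sliceA 3 lam u) = ymGerm + sliceGerm := by
  obtain ⟨hd, -, hr⟩ := germOfStn_divStn_sliceStn_remStn
  have happ := (germOfStn_append_smulS (fun lam => vecStn sTot lam (1 : Matrix Unit Unit ℝ) ++ smulS 2 (divStn lam (1 : Matrix Unit Unit ℝ)))
    (fun lam => remStn lam (1 : Matrix Unit Unit ℝ)) 0).1
  have happ' := (germOfStn_append_smulS (fun lam => vecStn sTot lam (1 : Matrix Unit Unit ℝ)) (fun lam => smulS 2 (divStn lam (1 : Matrix Unit Unit ℝ)))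
    0).1
  have hw : cubicGermOf (wilsonA 3) = bfGerm - sliceGerm := by
    rw [cubicGermOf_eq_germOfStn.1]
    change germOfStn (fun lam => (vecStn sTot lam (1 : Matrix Unit Unit ℝ) ++ smulS 2 (divStn lam 1)) ++ remStn lam 1) = _
    rw [happ, happ', germOfStn_vecStn, hd, hr, add_zero, sub_eq_add_neg]
  refine ⟨by rw [← cubicGermOf_wilsonA, hw], ?_⟩
  rw [cubicGermOf_bf]
  rfl

/-- [our object] **THE WILSON GERM DECOMPOSED ALONG `wilsonStn = vecStn sTot ++ 2•divStn ++ remStn`** (v1.1; the non-definitional content behind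
`three_readings`.1): on the LATTICE side `cubicGermOf (wilsonA 3) = germOfStn (vecStn sTot · 1) + germOfStn (2•divStn · 1) + germOfStn (remStn · 1)`, and the
three summands are `bfGerm` (current + `sTot`·spin), `−sliceGerm` (longitudinal) and `0` (`Graded 2` remainder) — three list-moment computations, each compared
with a germ DEFINED from the continuum Lagrangian (`BubbleGermValue`); with `SliceCubicGerm.cubicGermOf_sliceA` (`+sliceGerm`) the longitudinal germ and the
slice germ are OPPOSITE, which is `SliceVertex.bf_vertex` read at germ level. -/
theorem cubicGermOf_wilsonA_decomposed :
    cubicGermOf (wilsonA 3) =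
        germOfStn (fun lam => vecStn sTot lam (1 : Matrix Unit Unit ℝ)) + germOfStn (fun lam => smulS 2 (divStn lam (1 : Matrix Unit Unit ℝ)))
          + germOfStn (fun lam => remStn lam (1 : Matrix Unit Unit ℝ)) ∧
      germOfStn (fun lam => vecStn sTot lam (1 : Matrix Unit Unit ℝ)) = bfGerm ∧
        germOfStn (fun lam => smulS 2 (divStn lam (1 : Matrix Unit Unit ℝ))) = -sliceGerm ∧
          germOfStn (fun lam => remStn lam (1 : Matrix Unit Unit ℝ)) = 0 := by
  obtain ⟨hd, -, hr⟩ := germOfStn_divStn_sliceStn_remStn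
  refine ⟨?_, germOfStn_vecStn, hd, hr⟩
  have happ := (germOfStn_append_smulS (fun lam => vecStn sTot lam (1 : Matrix Unit Unit ℝ) ++ smulS 2 (divStn lam (1 : Matrix Unit Unit ℝ)))
    (fun lam => remStn lam (1 : Matrix Unit Unit ℝ)) 0).1
  have happ' := (germOfStn_append_smulS (fun lam => vecStn sTot lam (1 : Matrix Unit Unit ℝ)) (fun lam => smulS 2 (divStn lam (1 : Matrix Unit Unit ℝ)))
    0).1
  rw [cubicGermOf_eq_germOfStn.1]
  change germOfStn (fun lam => (vecStn sTot lam (1 : Matrix Unit Unit ℝ) ++ smulS 2 (divStn lam 1)) ++ remStn lam 1) = _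
  rw [happ, happ']

end Readings

end Summit.QuantumFields.BalabanUV.Beta.FP.SliceCubicGerm
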